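import Literature.Probability.RandomPlanarGeometry.AngleMartingaleProblemTilting
import Literature.Probability.Process.LevyCharacterisation
import Literature.Probability.Process.BrownianConcatenation
import Literature.Probability.Process.OptionalStopping
import HarnessLib
/-!
# The driving-angle increment of SLE_κ(ρ) under the tilted measure has a Brownian martingale clock

Topic `Probability/RandomPlanarGeometry`; theorems only, sequel of `AngleMartingaleProblemTilting`
and of the Lévy machinery `LevyCharacterisationCore` / `StoppedMartingale` (`Probability/Process`).
Under the tilted probability `Q` of `exists_tilted_measure` the coordinate process `X` solves the
`(κ, 0)` angle martingale problem on `[0, T]` for test functions supported in `(ε, 2π - ε)`. Testing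
it with `f₁ = x` and `f₂ = x²`, smoothly cut off outside `[2ε, 2π - 2ε]`, and stopping at the
optional time `τ` at which `X` leaves `[2ε, 2π - 2ε]` (`ratExceed`, Le Gall Prop. 3.9), shows that
the **driving-angle increment of whole-plane / radial SLE_κ(ρ)**

  `ξ_t = X_t - X_0 - ∫₀ᵗ cot(X_s/2) ds`     (`= λ_t - λ_0`, `drivingOfAngle`; Miller–Sheffield
  (2013), §2.1.2: `dW = i√κ W dB + (ρ/2) Ψ̃ dt`, Zhan (2021) §3: `dλ = √κ dB + (ρ/2) cot₂(X) dt`)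

stopped at `τ ∧ T` and divided by `√κ` is, under `Q`, an a.e. martingale `Y` with
`Y² - (t ∧ τ ∧ T)` an a.e. martingale — a `HasMartingaleClock` structure with clock `t ∧ τ ∧ T`
(`exists_hasMartingaleClock_drivingIncrement`). The square is handled by the carré-du-champ
identity `L(f²) = 2 f Lf + κ (f')²` and the integration-by-parts lemma of
`MartingaleFiniteVariation`, exactly as in Karatzas–Shreve (1988), Ch. 5, Prop. 4.6 (martingale
problem ⇒ `⟨M^f⟩ = ∫ κ (f')²(X)`); no stochastic integral is used. This is the input of Lévy's
characterisation (exponential martingale identity, `HasMartingaleClock.integral_mul_cexp_eq`) by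
which `ξ/√κ` is identified with a Brownian motion up to `τ ∧ T` (sequel).

Everything is proved; no definition and no named fact is introduced.

## References

* I. Karatzas, S. Shreve, *Brownian Motion and Stochastic Calculus* (1988), Ch. 5 §4.B,
  Prop. 4.6 and its proof. [KaratzasShreve1988]
* J. Miller, S. Sheffield, *Imaginary geometry IV*, PTRF 169 (2017), arXiv:1302.4738, §2.1.2,
  eq. (2.5); §2.1.3. [MillerSheffield2013]
* J.-F. Le Gall, *Brownian Motion, Martingales, and Stochastic Calculus* (2016), Prop. 3.9,
  Cor. 3.24, Thm 5.12. [Legall2016]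
-/

noncomputable section

open MeasureTheory ProbabilityTheory Filter Set Function Metric
open scoped NNReal ENNReal Topology

namespace Literature.Probability.RandomPlanarGeometry

open scoped PathBorel
open Literature.Probability.Process Literature.Analysis.FunctionSpaces Real

/-! ### The cut-off test functions `f₁ = x b(x)`, `f₂ = f₁²` -/

section TestFunctions

variable {b : ContDiffBump (π : ℝ)}

/-- `f₁ = x · b(x)` is smooth. [folklore] -/
theorem contDiff_mul_bump {n : ℕ∞} : ContDiff ℝ n fun x : ℝ ↦ x * b x :=
  contDiff_id.mul b.contDiff

/-- `tsupport (x b(x)) ⊆ closedBall π rOut`. [folklore] -/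
theorem tsupport_mul_bump_subset : tsupport (fun x : ℝ ↦ x * b x) ⊆ closedBall (π : ℝ) b.rOut :=
  tsupport_mul_subset_right.trans b.tsupport_eq.le

/-- Near a point of the inner ball, `x b(x) = x`. [folklore] -/
theorem mul_bump_eventuallyEq {x : ℝ} (hx : x ∈ ball (π : ℝ) b.rIn) :
    (fun y : ℝ ↦ y * b y) =ᶠ[𝓝 x] fun y ↦ y := by
  filter_upwards [b.eventuallyEq_one_of_mem_ball hx] with y hy
  simp [hy]

/-- On the inner ball: `f₁ = x`, `f₁' = 1`, `f₁'' = 0`. [folklore] -/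
theorem mul_bump_apply {x : ℝ} (hx : x ∈ ball (π : ℝ) b.rIn) : x * b x = x := by
  rw [b.one_of_mem_closedBall (ball_subset_closedBall hx), mul_one]

/-- `deriv f₁ = 1` on the inner ball. [folklore] -/
theorem deriv_mul_bump {x : ℝ} (hx : x ∈ ball (π : ℝ) b.rIn) : deriv (fun y : ℝ ↦ y * b y) x = 1 := by
  rw [(mul_bump_eventuallyEq hx).deriv_eq]; exact deriv_id x

/-- `iteratedDeriv 2 f₁ = 0` on the inner ball. [folklore] -/
theorem iteratedDeriv_two_mul_bump {x : ℝ} (hx : x ∈ ball (π : ℝ) b.rIn) :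
    iteratedDeriv 2 (fun y : ℝ ↦ y * b y) x = 0 := by
  rw [(mul_bump_eventuallyEq hx).iteratedDeriv_eq 2, iteratedDeriv_succ, iteratedDeriv_one]
  have : deriv (fun y : ℝ ↦ y) = fun _ ↦ (1 : ℝ) := by funext y; exact deriv_id y
  rw [this, deriv_const]

/-- **`L_0 f₁ = cot(x/2)` on the inner ball** (`L_0 = (κ/2) ∂² + cot(x/2) ∂`). [folklore] -/
theorem angleGenerator_mul_bump (κ : ℝ≥0) {x : ℝ} (hx : x ∈ ball (π : ℝ) b.rIn) :
    angleGenerator κ 0 (fun y : ℝ ↦ y * b y) x = Real.cot (x / 2) := by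
  rw [angleGenerator, deriv_mul_bump hx, iteratedDeriv_two_mul_bump hx]
  ring

/-- **Carré du champ of the angle generators**: `L(f²) = 2 f Lf + κ (f')²` for `f ∈ C²`.
[folklore] -/
theorem angleGenerator_sq (κ : ℝ≥0) (ρ : ℝ) {f : ℝ → ℝ} (hf : ContDiff ℝ 2 f) (x : ℝ) :
    angleGenerator κ ρ (fun y ↦ f y ^ 2) x =
      2 * f x * angleGenerator κ ρ f x + κ * deriv f x ^ 2 := by
  have h1 : deriv (fun y ↦ f y ^ 2) x = deriv f x * f x + f x * deriv f x := by
    have := deriv_mul_apply (G := f) (F := f) (hf.differentiable (by norm_num) x) (hf.differentiable (by norm_num) x)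
    simpa [sq] using this
  have h2 : iteratedDeriv 2 (fun y ↦ f y ^ 2) x =
      iteratedDeriv 2 f x * f x + 2 * deriv f x * deriv f x + f x * iteratedDeriv 2 f x := by
    have := iteratedDeriv_two_mul_apply (x := x) (hf.contDiffAt (x := x)) (hf.contDiffAt (x := x))
    simpa [sq] using this
  simp only [angleGenerator, h1, h2]
  ring

end TestFunctions

/-! ### The pathwise square identity of the martingale problem -/

section Square

/-- **The square identity** (pathwise, Karatzas–Shreve (1988), proof of Prop. 5.4.6): for
continuous `φ, ℓ, d : ℝ → ℝ` (the path functions `f(X_u)`, `Lf(X_u)`, `f'(X_u)`), with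
`A_r = ∫₀ʳ ℓ`, `N_r = φ_r - φ_0 - A_r`, and the `f²`-increment
`N²_r = φ_r² - φ_0² - ∫₀ʳ (κ d² + 2 φ ℓ)` (carré du champ), one has
`N_r² - κ ∫₀ʳ d² = N²_r - 2 φ_0 N_r - 2 (N_r A_r - ∫₀ʳ N_u ℓ_u du)`.
[cite: KaratzasShreve1988, Ch. 5 §4.B Prop. 4.6] -/
theorem sq_sub_integral_eq {φ ℓ d : ℝ → ℝ} (hφ : Continuous φ) (hℓ : Continuous ℓ) (hd : Continuous d)
    (κ r : ℝ) :
    (φ r - φ 0 - ∫ u in (0 : ℝ)..r, ℓ u) ^ 2 - κ * ∫ u in (0 : ℝ)..r, d u ^ 2 =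
      (φ r ^ 2 - φ 0 ^ 2 - ∫ u in (0 : ℝ)..r, (κ * d u ^ 2 + 2 * φ u * ℓ u)) -
        2 * φ 0 * (φ r - φ 0 - ∫ u in (0 : ℝ)..r, ℓ u) -
        2 * ((φ r - φ 0 - ∫ u in (0 : ℝ)..r, ℓ u) * (∫ u in (0 : ℝ)..r, ℓ u) -
          ∫ u in (0 : ℝ)..r, (φ u - φ 0 - ∫ s in (0 : ℝ)..u, ℓ s) * ℓ u) := by
  set A : ℝ → ℝ := fun u ↦ ∫ s in (0 : ℝ)..u, ℓ s with hA
  have hAderiv : ∀ u, HasDerivAt A (ℓ u) u := fun u ↦ (hℓ.integral_hasStrictDerivAt 0 u).hasDerivAt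
  have cA : Continuous A := continuous_iff_continuousAt.2 fun u ↦ (hAderiv u).continuousAt
  -- `∫₀ʳ A ℓ = A_r² / 2`
  have hAA : ∫ u in (0 : ℝ)..r, A u * ℓ u = A r ^ 2 / 2 := by
    have hF : ∀ u, HasDerivAt (fun u ↦ A u ^ 2 / 2) (A u * ℓ u) u := fun u ↦ by
      have := ((hAderiv u).pow 2).div_const 2
      refine this.congr_deriv ?_
      ring
    rw [intervalIntegral.integral_eq_sub_of_hasDerivAt (fun u _ ↦ hF u) ((cA.mul hℓ).intervalIntegrable 0 r)]
    simp [hA]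
  -- integrability of the pieces
  have i1 : IntervalIntegrable (fun u ↦ κ * d u ^ 2) volume 0 r := ((hd.pow 2).const_mul κ).intervalIntegrable 0 r
  have i2 : IntervalIntegrable (fun u ↦ 2 * φ u * ℓ u) volume 0 r :=
    ((hφ.const_mul 2).mul hℓ).intervalIntegrable 0 r
  have i3 : IntervalIntegrable (fun u ↦ φ u * ℓ u) volume 0 r := (hφ.mul hℓ).intervalIntegrable 0 r
  have i4 : IntervalIntegrable (fun u ↦ φ 0 * ℓ u) volume 0 r := (hℓ.const_mul _).intervalIntegrable 0 r
  have i5 : IntervalIntegrable (fun u ↦ A u * ℓ u) volume 0 r := (cA.mul hℓ).intervalIntegrable 0 r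
  have e1 : ∫ u in (0 : ℝ)..r, (κ * d u ^ 2 + 2 * φ u * ℓ u) =
      κ * (∫ u in (0 : ℝ)..r, d u ^ 2) + 2 * ∫ u in (0 : ℝ)..r, φ u * ℓ u := by
    rw [intervalIntegral.integral_add i1 i2, intervalIntegral.integral_const_mul]
    congr 1
    rw [← intervalIntegral.integral_const_mul]
    refine intervalIntegral.integral_congr fun u _ ↦ ?_
    ring
  have e2 : ∫ u in (0 : ℝ)..r, (φ u - φ 0 - A u) * ℓ u =
      (∫ u in (0 : ℝ)..r, φ u * ℓ u) - φ 0 * A r - A r ^ 2 / 2 := by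
    have heq : ∀ u, (φ u - φ 0 - A u) * ℓ u = (φ u * ℓ u - φ 0 * ℓ u) - A u * ℓ u := fun u ↦ by ring
    simp_rw [heq]
    rw [intervalIntegral.integral_sub (i3.sub i4) i5, intervalIntegral.integral_sub i3 i4,
      intervalIntegral.integral_const_mul, hAA]
  change (φ r - φ 0 - A r) ^ 2 - κ * ∫ u in (0 : ℝ)..r, d u ^ 2 =
    (φ r ^ 2 - φ 0 ^ 2 - ∫ u in (0 : ℝ)..r, (κ * d u ^ 2 + 2 * φ u * ℓ u)) -
      2 * φ 0 * (φ r - φ 0 - A r) - 2 * ((φ r - φ 0 - A r) * A r - ∫ u in (0 : ℝ)..r, (φ u - φ 0 - A u) * ℓ u)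
  rw [e1, e2]
  ring

end Square

/-! ### The exit time from `[2ε, 2π - 2ε]` and the behaviour of the path before it -/

section ExitTime

/-- The level process `|X_t - π|` is adapted. [folklore] -/
theorem adapted_abs_coordProc_sub : Adapted pastFiltration fun (t : ℝ≥0) (x : C(ℝ, ℝ)) ↦ |coordProc t x - π| :=
  fun t ↦ continuous_abs.measurable.comp ((adapted_coordProc t).sub measurable_const)

/-- The exit time of `X` from `[2ε, 2π - 2ε]` (as `ratExceed` of `|X - π|` at level `π - 2ε`) is an
optional time of the past filtration. [cite: Legall2016, Prop. 3.9] -/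
theorem isOptionalTime_exit (ε : ℝ) :
    IsOptionalTime pastFiltration (ratExceed (fun (t : ℝ≥0) (x : C(ℝ, ℝ)) ↦ |coordProc t x - π|) (π - 2 * ε)) :=
  isOptionalTime_ratExceed adapted_abs_coordProc_sub _

/-- Before the exit time the path stays in `[2ε, 2π - 2ε]` (when it starts there). [folklore] -/
theorem abs_sub_pi_le_of_le_exit {ε : ℝ} {x : C(ℝ, ℝ)} (h0 : |x 0 - π| ≤ π - 2 * ε) {s : ℝ≥0}
    (hs : (s : WithTop ℝ≥0) ≤ ratExceed (fun (t : ℝ≥0) (x : C(ℝ, ℝ)) ↦ |coordProc t x - π|) (π - 2 * ε) x) :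
    |x s - π| ≤ π - 2 * ε :=
  le_of_le_ratExceed (U := fun (t : ℝ≥0) (x : C(ℝ, ℝ)) ↦ |coordProc t x - π|)
    (continuous_abs.comp ((continuous_coordProc x).sub continuous_const)) (by simpa using h0) hs

/-- If the path starts outside `[2ε, 2π - 2ε]` the exit time is `0`. [folklore] -/
theorem exit_eq_zero_of_lt {ε : ℝ} {x : C(ℝ, ℝ)} (h0 : π - 2 * ε < |x 0 - π|) :
    ratExceed (fun (t : ℝ≥0) (x : C(ℝ, ℝ)) ↦ |coordProc t x - π|) (π - 2 * ε) x = 0 := by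
  refine le_antisymm ?_ bot_le
  have := ratExceed_le (U := fun (t : ℝ≥0) (x : C(ℝ, ℝ)) ↦ |coordProc t x - π|) (c := π - 2 * ε)
    (ω := x) (q := 0) (by simpa using h0)
  simpa using this

/-- A point of `[2ε, 2π - 2ε]` lies in the open ball `ball π (π - 3ε/2)` (`ε > 0`). [folklore] -/
theorem mem_ball_of_abs_sub_pi_le {ε y : ℝ} (hε : 0 < ε) (hy : |y - π| ≤ π - 2 * ε) :
    y ∈ ball (π : ℝ) (π - 3 * ε / 2) := by
  rw [mem_ball, Real.dist_eq]; linarith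

end ExitTime

/-! ### Two bookkeeping lemmas -/

section Bookkeeping

variable {Ω : Type*}

/-- **Killing the integrand after `T` freezes the time integral at `T`**:
`∫₀ᵗ 𝟙_{s ≤ T} g_s ds = ∫₀^{t ∧ T} g_s ds`. [folklore] -/
theorem timeIntegral_ite_le (g : ℝ≥0 → Ω → ℝ) (T t : ℝ≥0) (ω : Ω) :
    timeIntegral (fun s ω ↦ if s ≤ T then g s ω else 0) t ω = timeIntegral g (min t T) ω := by
  simp only [timeIntegral_apply_eq_intervalIntegral]
  rw [intervalIntegral.integral_of_le t.coe_nonneg, intervalIntegral.integral_of_le (min t T).coe_nonneg]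
  have hk : (fun s : ℝ ↦ if s.toNNReal ≤ T then g s.toNNReal ω else 0) =
      (Iic (T : ℝ)).indicator fun s ↦ g s.toNNReal ω := by
    funext s
    by_cases hs : s ≤ T
    · rw [indicator_of_mem (show s ∈ Iic (T : ℝ) from hs), if_pos (Real.toNNReal_le_iff_le_coe.2 hs)]
    · rw [indicator_of_notMem (show s ∉ Iic (T : ℝ) from hs), if_neg]
      rw [not_le] at hs ⊢
      exact (Real.lt_toNNReal_iff_coe_lt.2 hs)
  rw [hk, setIntegral_indicator measurableSet_Iic, Ioc_inter_Iic, NNReal.coe_min]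

/-- **Uniform bound for the martingale-problem increments up to a horizon**:
`|angleIncrement κ ρ f 0 r| ≤ 2 sup|f| + r sup|Lf|`. [folklore] -/
theorem abs_angleIncrement_zero_le {κ : ℝ≥0} {ρ : ℝ} {f : ℝ → ℝ} {Cf CL : ℝ} (hfb : ∀ y, |f y| ≤ Cf)
    (hLb : ∀ y, |angleGenerator κ ρ f y| ≤ CL) (r : ℝ≥0) (x : C(ℝ, ℝ)) :
    |angleIncrement κ ρ f 0 r x| ≤ 2 * Cf + CL * r := by
  unfold angleIncrement
  have h1 := hfb (x r)
  have h2 := hfb (x 0)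
  have h3 : |∫ u in (0 : ℝ)..r, angleGenerator κ ρ f (x u)| ≤ CL * r := by
    have := intervalIntegral.norm_integral_le_of_norm_le_const (a := (0 : ℝ)) (b := (r : ℝ))
      (f := fun u ↦ angleGenerator κ ρ f (x u)) (C := CL) fun u _ ↦ by rw [Real.norm_eq_abs]; exact hLb _
    rw [Real.norm_eq_abs, sub_zero, abs_of_nonneg r.coe_nonneg] at this
    exact this
  calc |f (x r) - f (x 0) - ∫ u in (0 : ℝ)..r, angleGenerator κ ρ f (x u)|
      ≤ |f (x r) - f (x 0)| + |∫ u in (0 : ℝ)..r, angleGenerator κ ρ f (x u)| := abs_sub _ _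
    _ ≤ (|f (x r)| + |f (x 0)|) + CL * r := add_le_add (abs_sub _ _) h3
    _ ≤ 2 * Cf + CL * r := by linarith

end Bookkeeping

/-! ### The martingale clock of the driving-angle increment under the tilted measure -/

section Clock

variable {κ : ℝ≥0} {ρ : ℝ} {P : Measure C(ℝ, ℝ)}

/-- **The martingale clock of the driving increment under the `(κ, 0)` martingale problem on
`[0, T]`.** Let `Q` be a probability measure on two-sided angle paths under which, for every `C²`
test function `f` supported in `(ε, 2π - ε)`, `t ↦ f(X_{t∧T}) - f(X_0) - ∫₀^{t∧T} L₀ f(X_u) du`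
(`L₀ = angleGenerator κ 0`) is a `pastFiltration`-martingale (`hMPQ`; e.g. the tilted measure of
`exists_tilted_measure`, or — for `ρ = 0` — a stationary SLE_κ(0) angle law itself). With
`τ = inf {t ≥ 0 : |X_t - π| > π - 2ε}` (`ratExceed`, an optional time), the normalised
driving-angle increment stopped at `τ` and frozen after `T`,

  `Y_t = ξ_{t ∧ τ ∧ T} / √κ`,  `ξ_r = X_r - X_0 - ∫₀ʳ cot(X_u/2) du`,

and the clock `c_t = t ∧ τ ∧ T` satisfy `HasMartingaleClock Y c pastFiltration Q N`; the stopped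
process has continuous paths and is adapted. (Karatzas–Shreve (1988), Ch. 5, Prop. 4.6: under a
solution of the martingale problem for `L = (κ/2)∂² + b ∂`, `M = X - X_0 - ∫ b(X)` is a continuous
local martingale with `⟨M⟩ = κ t`; here via the cut-off test functions `x b(x)` and `(x b(x))²`,
the carré du champ, integration by parts against `∫ Lf(X)`, and optional stopping at `τ`.)
[cite: KaratzasShreve1988, Ch. 5 §4.B Prop. 4.6] -/
theorem hasMartingaleClock_drivingIncrement_of_martingale (Q : Measure C(ℝ, ℝ))
    [IsProbabilityMeasure Q] (hκ : 0 < κ) {ε : ℝ} (hε : 0 < ε) (hε2 : ε < π / 2) (T : ℝ≥0)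
    (hMPQ : ∀ f : ℝ → ℝ, ContDiff ℝ 2 f → tsupport f ⊆ Ioo ε (2 * π - ε) →
      Martingale (fun (t : ℝ≥0) x ↦ angleIncrement κ 0 f 0 (min t T) x) pastFiltration Q) :
    (∀ x, Continuous fun t ↦ stoppedProcess (fun (t : ℝ≥0) (x : C(ℝ, ℝ)) ↦
        (x (min t T) - x 0 - ∫ u in (0 : ℝ)..(min t T), Real.cot (x u / 2)) / Real.sqrt κ)
        (ratExceed (fun (t : ℝ≥0) (x : C(ℝ, ℝ)) ↦ |coordProc t x - π|) (π - 2 * ε)) t x) ∧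
    (∀ t, StronglyMeasurable[pastFiltration t] (stoppedProcess (fun (t : ℝ≥0) (x : C(ℝ, ℝ)) ↦
        (x (min t T) - x 0 - ∫ u in (0 : ℝ)..(min t T), Real.cot (x u / 2)) / Real.sqrt κ)
        (ratExceed (fun (t : ℝ≥0) (x : C(ℝ, ℝ)) ↦ |coordProc t x - π|) (π - 2 * ε)) t)) ∧
    ∃ N : ℝ, HasMartingaleClock
      (stoppedProcess (fun (t : ℝ≥0) (x : C(ℝ, ℝ)) ↦
        (x (min t T) - x 0 - ∫ u in (0 : ℝ)..(min t T), Real.cot (x u / 2)) / Real.sqrt κ)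
        (ratExceed (fun (t : ℝ≥0) (x : C(ℝ, ℝ)) ↦ |coordProc t x - π|) (π - 2 * ε)))
      (fun t x ↦ ((min (min (t : WithTop ℝ≥0)
        (ratExceed (fun (t : ℝ≥0) (x : C(ℝ, ℝ)) ↦ |coordProc t x - π|) (π - 2 * ε) x)).untopA T : ℝ≥0) : ℝ))
      pastFiltration Q N := by
  -- the cut-off test functions
  let b : ContDiffBump (π : ℝ) := ⟨π - 3 * ε / 2, π - 5 * ε / 4, by linarith, by linarith⟩
  have hbIn : b.rIn = π - 3 * ε / 2 := rfl
  have hbOut : b.rOut = π - 5 * ε / 4 := rfl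
  set f₁ : ℝ → ℝ := fun y ↦ y * b y with hf₁
  set f₂ : ℝ → ℝ := fun y ↦ f₁ y ^ 2 with hf₂
  have hf₁C : ContDiff ℝ 2 f₁ := contDiff_mul_bump
  have hf₂C : ContDiff ℝ 2 f₂ := hf₁C.pow 2
  have hsupp₁ : tsupport f₁ ⊆ Ioo ε (2 * π - ε) := by
    refine tsupport_mul_bump_subset.trans fun y hy ↦ ?_
    rw [mem_closedBall, Real.dist_eq, hbOut, abs_le] at hy
    constructor <;> linarith [hy.1, hy.2]
  have hsupp₂ : tsupport f₂ ⊆ Ioo ε (2 * π - ε) := by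
    refine Subset.trans ?_ hsupp₁
    simp only [hf₂, sq]
    exact tsupport_mul_subset_left
  have hsupp₁' : tsupport f₁ ⊆ Ioo 0 (2 * π) := hsupp₁.trans (Ioo_subset_Ioo hε.le (by linarith))
  have hsupp₂' : tsupport f₂ ⊆ Ioo 0 (2 * π) := hsupp₂.trans (Ioo_subset_Ioo hε.le (by linarith))
  have hcpt₁ : HasCompactSupport f₁ := hasCompactSupport_of_tsupport_subset_Ioo hsupp₁
  have hcpt₂ : HasCompactSupport f₂ := hasCompactSupport_of_tsupport_subset_Ioo hsupp₂
  obtain ⟨Cf, -, hCf⟩ := exists_bound_of_hasCompactSupport hf₁C.continuous hcpt₁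
  obtain ⟨CL, hCL0, hCL⟩ := exists_bound_angleGenerator (κ := κ) (ρ := 0) hf₁C hcpt₁ hsupp₁'
  have hLc : Continuous (angleGenerator κ 0 f₁) := continuous_angleGenerator hf₁C hsupp₁'
  have hdc : Continuous (deriv f₁) := hf₁C.continuous_deriv (by norm_num)
  -- on `[2ε, 2π - 2ε]`: `f₁ = x`, `Lf₁ = cot(x/2)`, `f₁' = 1`
  have hball : ∀ {y : ℝ}, |y - π| ≤ π - 2 * ε → y ∈ ball (π : ℝ) b.rIn := fun hy ↦ by
    rw [hbIn]; exact mem_ball_of_abs_sub_pi_le hε hy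
  -- the two `Q`-martingales and the optional time
  have hN1 := hMPQ f₁ hf₁C hsupp₁
  have hN2 := hMPQ f₂ hf₂C hsupp₂
  set τ := ratExceed (fun (t : ℝ≥0) (x : C(ℝ, ℝ)) ↦ |coordProc t x - π|) (π - 2 * ε) with hτdef
  have hτ : IsOptionalTime pastFiltration τ := isOptionalTime_exit ε
  set G : ℝ≥0 → C(ℝ, ℝ) → ℝ := fun t x ↦ angleIncrement κ 0 f₁ 0 (min t T) x with hGdef
  -- progressivity and bounds of `G`
  have hX : IsStronglyProgressive pastFiltration coordProc := isStronglyProgressive_coordProc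
  have hGprog : IsStronglyProgressive pastFiltration G := by
    have h1 : IsStronglyProgressive pastFiltration fun (t : ℝ≥0) x ↦ f₁ (coordProc t x) - f₁ (coordProc 0 x) -
        timeIntegral (fun s x ↦ angleGenerator κ 0 f₁ (coordProc s x)) t x :=
      ((IsStronglyProgressive.continuous_comp hX hf₁C.continuous).sub
        (IsStronglyProgressive.continuous_comp hX.initial hf₁C.continuous)).sub
        (isStronglyProgressive_timeIntegral (IsStronglyProgressive.continuous_comp hX hLc))
    have h2 := h1.min_const T
    have heq : G = fun t x ↦ f₁ (coordProc (min t T) x) - f₁ (coordProc 0 x) -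
        timeIntegral (fun s x ↦ angleGenerator κ 0 f₁ (coordProc s x)) (min t T) x := by
      funext t x; exact angleIncrement_zero_eq κ 0 f₁ (min t T) x
    rw [heq]; exact h2
  have hGb : ∀ t x, |G t x| ≤ 2 * Cf + CL * T := fun t x ↦
    (abs_angleIncrement_zero_le hCf hCL (min t T) x).trans (by gcongr; exact min_le_right t T)
  -- the pairing `Π = G ∫ h - ∫ G h`, `h = 𝟙_{≤ T} Lf₁(X)`
  set h : ℝ≥0 → C(ℝ, ℝ) → ℝ := fun s x ↦ if s ≤ T then angleGenerator κ 0 f₁ (coordProc s x) else 0 with hhdef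
  have hhprog : IsStronglyProgressive pastFiltration h :=
    (IsStronglyProgressive.continuous_comp hX hLc).indicator_le_const T
  have hhb : ∀ s x, |h s x| ≤ CL := fun s x ↦ by
    by_cases hs : s ≤ T
    · simp only [hhdef, if_pos hs]; exact hCL _
    · simp only [hhdef, if_neg hs, abs_zero]; exact hCL0
  have hPair := martingale_mul_timeIntegral_sub hN1 hGprog (IsStronglyProgressive.measurable_uncurry hGprog)
    hGb hhprog (IsStronglyProgressive.measurable_uncurry hhprog) hhb
  -- the square process `Z = G² - κ ∫₀^{·∧T} f₁'(X)²` and its martingale decomposition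
  set Z : ℝ≥0 → C(ℝ, ℝ) → ℝ := fun t x ↦ G t x ^ 2 -
    κ * timeIntegral (fun s x ↦ if s ≤ T then deriv f₁ (coordProc s x) ^ 2 else 0) t x with hZdef
  have hZeq : ∀ t x, Z t x = angleIncrement κ 0 f₂ 0 (min t T) x - 2 * (f₁ (coordProc 0 x) * G t x) -
      2 * (G t x * timeIntegral h t x - timeIntegral (fun s x ↦ G s x * h s x) t x) := by
    intro t x
    -- path functions
    set φ : ℝ → ℝ := fun u ↦ f₁ (x u) with hφdef
    set ℓ : ℝ → ℝ := fun u ↦ angleGenerator κ 0 f₁ (x u) with hℓdef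
    set d : ℝ → ℝ := fun u ↦ deriv f₁ (x u) with hddef
    have cφ : Continuous φ := hf₁C.continuous.comp x.continuous
    have cℓ : Continuous ℓ := hLc.comp x.continuous
    have cd : Continuous d := hdc.comp x.continuous
    set r : ℝ := min (t : ℝ) T with hrdef
    have hrT : r ≤ T := min_le_right _ _
    have hr0 : 0 ≤ r := le_min t.coe_nonneg T.coe_nonneg
    have e1 : G t x = φ r - φ 0 - ∫ u in (0 : ℝ)..r, ℓ u := rfl
    have e2 : timeIntegral (fun s x ↦ if s ≤ T then deriv f₁ (coordProc s x) ^ 2 else 0) t x =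
        ∫ u in (0 : ℝ)..r, d u ^ 2 := by
      rw [timeIntegral_ite_le (fun s x ↦ deriv f₁ (coordProc s x) ^ 2) T t x,
        timeIntegral_coordProc (fun y ↦ deriv f₁ y ^ 2), NNReal.coe_min]
    have e3 : angleIncrement κ 0 f₂ 0 r x = φ r ^ 2 - φ 0 ^ 2 - ∫ u in (0 : ℝ)..r, (κ * d u ^ 2 + 2 * φ u * ℓ u) := by
      simp only [angleIncrement, hf₂]
      congr 1
      refine intervalIntegral.integral_congr fun u _ ↦ ?_
      rw [angleGenerator_sq κ 0 hf₁C]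
      ring
    have e4 : timeIntegral h t x = ∫ u in (0 : ℝ)..r, ℓ u := by
      rw [timeIntegral_ite_le (fun s x ↦ angleGenerator κ 0 f₁ (coordProc s x)) T t x,
        timeIntegral_coordProc (angleGenerator κ 0 f₁), NNReal.coe_min]
    have e5 : timeIntegral (fun s x ↦ G s x * h s x) t x =
        ∫ u in (0 : ℝ)..r, (φ u - φ 0 - ∫ s in (0 : ℝ)..u, ℓ s) * ℓ u := by
      have hk : (fun s x ↦ G s x * h s x) = fun s x ↦
          if s ≤ T then G s x * angleGenerator κ 0 f₁ (coordProc s x) else 0 := by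
        funext s x; simp only [hhdef, mul_ite, mul_zero]
      rw [hk, timeIntegral_ite_le (fun s x ↦ G s x * angleGenerator κ 0 f₁ (coordProc s x)) T t x,
        timeIntegral_apply_eq_intervalIntegral, NNReal.coe_min]
      refine intervalIntegral.integral_congr fun u hu ↦ ?_
      rw [uIcc_of_le hr0] at hu
      have hu0 : 0 ≤ u := hu.1
      have huT : u ≤ (T : ℝ) := hu.2.trans hrT
      have huT' : min u (T : ℝ) = u := min_eq_left huT
      simp only [hGdef, coordProc_apply, Real.coe_toNNReal _ hu0, huT']
      rfl
    rw [hZdef]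
    simp only
    rw [e2, e3, e4, e5, e1, coordProc_apply, NNReal.coe_zero]
    linear_combination sq_sub_integral_eq cφ cℓ cd κ r
  have hf0m : StronglyMeasurable[pastFiltration 0] fun x : C(ℝ, ℝ) ↦ f₁ (coordProc 0 x) :=
    hf₁C.continuous.comp_stronglyMeasurable (hX.stronglyAdapted 0)
  have hG0 : G 0 = 0 := by funext x; simp [hGdef]
  have hmul : Martingale (fun t x ↦ f₁ (coordProc 0 x) * G t x) pastFiltration Q :=
    hN1.bdd_mul_of_apply_zero hG0 hf0m ⟨Cf, fun x ↦ hCf _⟩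
  have hZ : Martingale Z pastFiltration Q := by
    have hm := (hN2.sub (hmul.smul (2 : ℝ))).sub (hPair.smul (2 : ℝ))
    have heq : Z = (fun (t : ℝ≥0) x ↦ angleIncrement κ 0 f₂ 0 (min t T) x) -
        (2 : ℝ) • (fun t x ↦ f₁ (coordProc 0 x) * G t x) -
        (2 : ℝ) • (fun t x ↦ G t x * timeIntegral h t x - timeIntegral (fun s x ↦ G s x * h s x) t x) := by
      funext t x
      rw [hZeq t x]
      simp only [Pi.sub_apply, Pi.smul_apply, smul_eq_mul]
    rw [heq]
    exact hm
  -- continuity of paths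
  have hGcont : ∀ x, Continuous (G · x) := fun x ↦
    (continuous_angleIncrement_time hf₁C hsupp₁' 0 x).comp
      (NNReal.continuous_coe.comp (continuous_id.min continuous_const))
  have hZcont : ∀ x, Continuous (Z · x) := fun x ↦ by
    have h2 : Continuous fun t : ℝ≥0 ↦ timeIntegral
        (fun s x ↦ if s ≤ T then deriv f₁ (coordProc s x) ^ 2 else 0) t x := by
      have heq : (fun t : ℝ≥0 ↦ timeIntegral (fun s x ↦ if s ≤ T then deriv f₁ (coordProc s x) ^ 2 else 0) t x) =
          (fun r : ℝ ↦ ∫ u in (0 : ℝ)..r, deriv f₁ (x u) ^ 2) ∘ fun t : ℝ≥0 ↦ ((min t T : ℝ≥0) : ℝ) := by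
        funext t
        simp only [Function.comp]
        rw [timeIntegral_ite_le (fun s x ↦ deriv f₁ (coordProc s x) ^ 2) T t x,
          timeIntegral_coordProc (fun y ↦ deriv f₁ y ^ 2)]
      rw [heq]
      refine Continuous.comp ?_ (NNReal.continuous_coe.comp (continuous_id.min continuous_const))
      have hc : Continuous fun u ↦ deriv f₁ (x u) ^ 2 := (hdc.comp x.continuous).pow 2
      exact intervalIntegral.continuous_primitive (μ := volume) (fun a b ↦ hc.intervalIntegrable a b) 0
    exact ((hGcont x).pow 2).sub (continuous_const.mul h2)
  -- optional stopping
  have hY' : IsAEMartingale (stoppedProcess G τ) pastFiltration Q :=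
    hN1.isAEMartingale_stoppedProcess (ae_of_all _ hGcont) hτ
  have hZ' : IsAEMartingale (stoppedProcess Z τ) pastFiltration Q :=
    hZ.isAEMartingale_stoppedProcess (ae_of_all _ hZcont) hτ
  -- identification of the stopped processes with `Y`, `Y² - c`
  have hsqrt : Real.sqrt κ ≠ 0 := (Real.sqrt_pos.2 (by exact_mod_cast hκ)).ne'
  have hsq : Real.sqrt κ ^ 2 = κ := Real.sq_sqrt (NNReal.coe_nonneg κ)
  -- value of `G` and of the integrals before `τ`
  have key : ∀ x (w : ℝ≥0), ((w : ℝ≥0) : WithTop ℝ≥0) ≤ τ x →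
      angleIncrement κ 0 f₁ 0 (min (w : ℝ) T) x =
        x (min (w : ℝ) T) - x 0 - ∫ u in (0 : ℝ)..(min (w : ℝ) T), Real.cot (x u / 2) ∧
      timeIntegral (fun s x ↦ if s ≤ T then deriv f₁ (coordProc s x) ^ 2 else 0) w x = min (w : ℝ) T := by
    intro x w hw
    rw [timeIntegral_ite_le (fun s x ↦ deriv f₁ (coordProc s x) ^ 2) T w x,
      timeIntegral_coordProc (fun y ↦ deriv f₁ y ^ 2)]
    have hcoe : ((min w T : ℝ≥0) : ℝ) = min (w : ℝ) T := NNReal.coe_min w T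
    rw [hcoe]
    have hm0 : 0 ≤ min (w : ℝ) T := le_min w.coe_nonneg T.coe_nonneg
    by_cases h0 : |x 0 - π| ≤ π - 2 * ε
    · have hwτ : ((min w T : ℝ≥0) : WithTop ℝ≥0) ≤ τ x := (WithTop.coe_le_coe.2 (min_le_left w T)).trans hw
      have hin : ∀ u ∈ uIcc (0 : ℝ) (min (w : ℝ) T), x u ∈ ball (π : ℝ) b.rIn := fun u hu ↦ by
        rw [uIcc_of_le hm0] at hu
        have hu2 : u.toNNReal ≤ min w T :=
          Real.toNNReal_le_iff_le_coe.2 (hu.2.trans_eq hcoe.symm)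
        have hu' : ((u.toNNReal : ℝ≥0) : WithTop ℝ≥0) ≤ τ x := (WithTop.coe_le_coe.2 hu2).trans hwτ
        have := abs_sub_pi_le_of_le_exit h0 hu'
        rw [Real.coe_toNNReal _ hu.1] at this
        exact hball this
      have hin_r : x (min (w : ℝ) T) ∈ ball (π : ℝ) b.rIn := hin _ right_mem_uIcc
      have hin_0 : x 0 ∈ ball (π : ℝ) b.rIn := hin 0 left_mem_uIcc
      have hf₁r : f₁ (x (min (w : ℝ) T)) = x (min (w : ℝ) T) := mul_bump_apply hin_r
      have hf₁0 : f₁ (x 0) = x 0 := mul_bump_apply hin_0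
      constructor
      · unfold angleIncrement
        rw [hf₁r, hf₁0]
        congr 1
        exact intervalIntegral.integral_congr fun u hu ↦ angleGenerator_mul_bump κ (hin u hu)
      · rw [intervalIntegral.integral_congr (g := fun _ ↦ (1 : ℝ)) fun u hu ↦ by
          show deriv f₁ (x u) ^ 2 = 1
          rw [show deriv f₁ (x u) = 1 from deriv_mul_bump (hin u hu), one_pow]]
        simp
    · -- the path starts outside: `τ = 0`, `w = 0`
      have hτ0 : τ x = 0 := exit_eq_zero_of_lt (not_le.1 h0)
      have hw0 : w = 0 := by
        rw [hτ0] at hw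
        exact le_antisymm (by exact_mod_cast hw) bot_le
      subst hw0
      have h00 : min ((0 : ℝ≥0) : ℝ) (T : ℝ) = 0 := by rw [NNReal.coe_zero]; exact min_eq_left T.coe_nonneg
      rw [h00]
      simp [angleIncrement]
  set Y : ℝ≥0 → C(ℝ, ℝ) → ℝ := stoppedProcess (fun (t : ℝ≥0) (x : C(ℝ, ℝ)) ↦
    (x (min t T) - x 0 - ∫ u in (0 : ℝ)..(min t T), Real.cot (x u / 2)) / Real.sqrt κ) τ with hYdef
  set c : ℝ≥0 → C(ℝ, ℝ) → ℝ := fun t x ↦ ((min (min (t : WithTop ℝ≥0) (τ x)).untopA T : ℝ≥0) : ℝ)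
    with hcdef
  have hid1 : ∀ t x, stoppedProcess G τ t x = Real.sqrt κ * Y t x := by
    intro t x
    simp only [hYdef, stoppedProcess, hGdef]
    rw [mul_div_cancel₀ _ hsqrt]
    exact (key x _ (Literature.Probability.Process.coe_untopA_min_le t (τ x))).1
  have hid2 : ∀ t x, stoppedProcess Z τ t x = κ * (Y t x ^ 2 - c t x) := by
    intro t x
    have h1 := hid1 t x
    simp only [stoppedProcess] at h1 ⊢
    simp only [hZdef, hcdef]
    rw [h1, (key x _ (Literature.Probability.Process.coe_untopA_min_le t (τ x))).2, mul_pow, hsq, NNReal.coe_min]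
    ring
  have heqY : Y = fun t x ↦ (Real.sqrt κ)⁻¹ * stoppedProcess G τ t x := by
    funext t x; rw [hid1 t x, ← mul_assoc, inv_mul_cancel₀ hsqrt, one_mul]
  refine ⟨fun x ↦ ?_, fun t ↦ ?_, (2 * Cf + CL * T) / Real.sqrt κ, ?_⟩
  · -- continuity of the paths of `Y`
    rw [heqY]
    exact continuous_const.mul
      (Literature.Probability.Process.continuous_stoppedProcess_path (hGcont x) τ)
  · -- adaptedness of `Y`
    rw [heqY]
    exact ((hτ.stronglyAdapted_stoppedProcess hGprog) t).const_mul _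
  -- the clock structure
  exact
    { isAEMartingale := by
        have h := hY'.const_mul (Real.sqrt κ)⁻¹
        have heq : (fun t ω ↦ (Real.sqrt κ)⁻¹ * stoppedProcess G τ t ω) = Y := by
          funext t x; rw [hid1 t x, ← mul_assoc, inv_mul_cancel₀ hsqrt, one_mul]
        rwa [heq] at h
      isAEMartingale_sq_sub := by
        have h := hZ'.const_mul (κ : ℝ)⁻¹
        have hκ0 : (κ : ℝ) ≠ 0 := by exact_mod_cast hκ.ne'
        have heq : (fun t ω ↦ (κ : ℝ)⁻¹ * stoppedProcess Z τ t ω) = fun t x ↦ Y t x ^ 2 - c t x := by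
          funext t x; rw [hid2 t x, ← mul_assoc, inv_mul_cancel₀ hκ0, one_mul]
        rwa [heq] at h
      clock_zero := fun x ↦ by simp only [hcdef, untopA_min_zero, zero_le, min_eq_left, NNReal.coe_zero]
      clock_mono := fun x s t hst ↦ by
        simp only [hcdef]
        exact_mod_cast min_le_min_right T (untopA_min_mono (τ x) hst)
      clock_sub_le := fun x s t hst ↦ by
        simp only [hcdef]
        have h1 := untopA_min_sub_le (τ x) hst
        have h2 := untopA_min_mono (τ x) hst
        set a := (min (s : WithTop ℝ≥0) (τ x)).untopA
        set a' := (min (t : WithTop ℝ≥0) (τ x)).untopA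
        have : ((min a' T : ℝ≥0) : ℝ) - (min a T : ℝ≥0) ≤ (a' : ℝ) - a := by
          push_cast
          rcases le_total (a' : ℝ) T with h | h
          · rw [min_eq_left h, min_eq_left ((NNReal.coe_le_coe.2 h2).trans h)]
          · rw [min_eq_right h]
            rcases le_total (a : ℝ) T with h' | h'
            · rw [min_eq_left h']; linarith
            · rw [min_eq_right h']; have := NNReal.coe_le_coe.2 h2; linarith
        linarith
      abs_le := ae_of_all _ fun x t ↦ by
        have h1 := hid1 t x
        have hYeq : Y t x = stoppedProcess G τ t x / Real.sqrt κ := by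
          rw [h1, mul_div_cancel_left₀ _ hsqrt]
        rw [hYeq, abs_div, abs_of_pos (Real.sqrt_pos.2 (by exact_mod_cast hκ))]
        exact div_le_div_of_nonneg_right (hGb _ _) (Real.sqrt_pos.2 (by exact_mod_cast hκ)).le }


/-- **The driving-angle increment of SLE_κ(ρ) has a Brownian martingale clock under the tilted
measure.** Let `P` solve the `(κ, ρ)` angle martingale problem in martingale form on `[0, ∞)`
(`κ > 0`), let `0 < ε < π/2` and `T ≥ 0`. There are a probability measure `Q`, mutually absolutely
continuous with `P` (the tilted measure of `exists_tilted_measure`), and a constant `N` such that,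
with `τ` the exit time of `X` from `[2ε, 2π - 2ε]` (`ratExceed` of `|X - π|`), the process

  `Y_t = ξ_{t ∧ τ ∧ T} / √κ`,  `ξ_r = X_r - X_0 - ∫₀ʳ cot(X_u/2) du`  (driving-angle increment),

and the clock `c_t = t ∧ τ ∧ T` satisfy `HasMartingaleClock Y c pastFiltration Q N`: `Y` and
`Y² - c` are a.e. martingales, `|Y| ≤ N`. (Karatzas–Shreve (1988), Ch. 5, Prop. 4.6: under a
solution of the martingale problem for `L = (κ/2)∂² + b ∂`, `M = X - X_0 - ∫ b(X)` is a continuous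
local martingale with `⟨M⟩ = κ t`; here `b = cot(·/2)` under `Q`, localised to `[2ε, 2π - 2ε]` and
`[0, T]`, via the cut-off test functions `x b(x)` and `(x b(x))²`, the carré du champ, integration by
parts against `∫ Lf(X)`, and optional stopping at the optional time `τ`.)
The stopped process has continuous paths and is adapted (exported for the concatenation step).
[cite: KaratzasShreve1988, Ch. 5 §4.B Prop. 4.6] -/
theorem exists_hasMartingaleClock_drivingIncrement [IsProbabilityMeasure P] (hκ : 0 < κ)
    (hMP : ∀ f : ℝ → ℝ, ContDiff ℝ 2 f → HasCompactSupport f → tsupport f ⊆ Ioo 0 (2 * π) →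
      Martingale (fun (t : ℝ≥0) x ↦ angleIncrement κ ρ f 0 t x) pastFiltration P)
    {ε : ℝ} (hε : 0 < ε) (hε2 : ε < π / 2) (T : ℝ≥0) :
    ∃ Q : Measure C(ℝ, ℝ), IsProbabilityMeasure Q ∧ P ≪ Q ∧ Q ≪ P ∧
      (∀ x, Continuous fun t ↦ stoppedProcess (fun (t : ℝ≥0) (x : C(ℝ, ℝ)) ↦
          (x (min t T) - x 0 - ∫ u in (0 : ℝ)..(min t T), Real.cot (x u / 2)) / Real.sqrt κ)
          (ratExceed (fun (t : ℝ≥0) (x : C(ℝ, ℝ)) ↦ |coordProc t x - π|) (π - 2 * ε)) t x) ∧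
      (∀ t, StronglyMeasurable[pastFiltration t] (stoppedProcess (fun (t : ℝ≥0) (x : C(ℝ, ℝ)) ↦
          (x (min t T) - x 0 - ∫ u in (0 : ℝ)..(min t T), Real.cot (x u / 2)) / Real.sqrt κ)
          (ratExceed (fun (t : ℝ≥0) (x : C(ℝ, ℝ)) ↦ |coordProc t x - π|) (π - 2 * ε)) t)) ∧
      ∃ N : ℝ, HasMartingaleClock
        (stoppedProcess (fun (t : ℝ≥0) (x : C(ℝ, ℝ)) ↦
          (x (min t T) - x 0 - ∫ u in (0 : ℝ)..(min t T), Real.cot (x u / 2)) / Real.sqrt κ)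
          (ratExceed (fun (t : ℝ≥0) (x : C(ℝ, ℝ)) ↦ |coordProc t x - π|) (π - 2 * ε)))
        (fun t x ↦ ((min (min (t : WithTop ℝ≥0)
          (ratExceed (fun (t : ℝ≥0) (x : C(ℝ, ℝ)) ↦ |coordProc t x - π|) (π - 2 * ε) x)).untopA T : ℝ≥0) : ℝ))
        pastFiltration Q N := by
  have hεπ : ε < π := by linarith [Real.pi_pos]
  obtain ⟨Q, hQ, hPQ, hQP, hMPQ⟩ := exists_tilted_measure hκ hMP hε hεπ T
  haveI := hQ
  exact ⟨Q, hQ, hPQ, hQP, hasMartingaleClock_drivingIncrement_of_martingale Q hκ hε hε2 T hMPQ⟩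

end Clock

end Literature.Probability.RandomPlanarGeometry

/-!
# The driving-angle increment of whole-plane SLE_κ(ρ) is absolutely continuous w.r.t. Brownian motion

Topic `Probability/RandomPlanarGeometry`; theorems only. Let `P` be a probability measure on
two-sided angle paths `C(ℝ, ℝ)` solving the SLE_κ(ρ) angle martingale problem (in the form
`hMP` of `AngleMartingaleProblemTilting`: `f(X_t) - f(X_0) - ∫₀ᵗ L_ρ f(X)` is a martingale of the
past filtration for every `C²` test function supported in `(0, 2π)`), under which the angle stays in
`(0, 2π)` on `[0, T]` a.s. Then the (normalised) **driving-angle increment**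

  `ξ_t = (X_{t ∧ T} - X_0 - ∫₀^{t ∧ T} cot(X_u / 2) du) / √κ = (λ_{t ∧ T} - λ_0) / √κ`

(`λ = drivingOfAngle q₀ X`) has a law **absolutely continuous with respect to Brownian motion** on
`[0, T]`: every set of paths that is null for (the `T`-stopped path of) every real Brownian motion is
null for `ξ` under `P` (`drivingIncrement_null_of_brownian_null`). This is the absolute-continuity
statement by which Miller–Sheffield (2013), proof of Prop. 2.5, transfer almost-sure properties of
radial SLE_κ to whole-plane SLE_κ(ρ) away from the starting time ("the law of `W` restricted to
`[t₀, t₀ + T]` is absolutely continuous with respect to that of radial SLE_κ", via the Girsanov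
theorem). It is proved here WITHOUT stochastic calculus: by the exponential change of measure for
the martingale problem (`TiltedAngleClock`: under an equivalent measure `Q_ε` the increment
stopped at the exit time `τ_ε` of `[2ε, 2π - 2ε]` has the martingale clock `t ∧ τ_ε ∧ T`), the
concatenation with an independent Brownian motion (`BrownianConcatenation`: the concatenated process
is a Brownian motion agreeing with `ξ` up to `τ_ε ∧ T`), and exhaustion `ε ↓ 0` using that the
angle stays inside `(0, 2π)`.

## References

* J. Miller, S. Sheffield, *Imaginary geometry IV* (2013/2017), §2.1, proof of Prop. 2.5.
  [MillerSheffield2013]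
* D. Revuz, M. Yor, *Continuous Martingales and Brownian Motion* (1999), Ch. VIII §1
  (Girsanov) and Ch. V Thm (1.7). [RevuzYor1999]
-/

noncomputable section

open MeasureTheory ProbabilityTheory Filter Set Function
open scoped NNReal ENNReal Topology

namespace Literature.Probability.RandomPlanarGeometry

open scoped PathBorel
open Literature.Probability.Process Real

variable {κ : ℝ≥0} {ρ : ℝ} {P : Measure C(ℝ, ℝ)}

/-! ### Bookkeeping on the stopped clock -/

/-- `(t ∧ τ) ∧ T = t ∧ (T ∧ τ)` for the truncated optional time. [folklore] -/
theorem min_untopA_min_eq (t T : ℝ≥0) (τ : WithTop ℝ≥0) :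
    min (min (t : WithTop ℝ≥0) τ).untopA T = min t (min (T : WithTop ℝ≥0) τ).untopA := by
  induction τ using WithTop.recTopCoe with
  | top => rw [untopA_min_coe_top, untopA_min_coe_top]
  | coe a =>
    rw [untopA_min_coe_coe, untopA_min_coe_coe, min_assoc, min_comm a T]

/-- If the path stays within distance `π - 2ε` of `π` at all times of `[0, T]`, the exit time
`τ_ε` is at least `T`. [folklore] -/
theorem coe_le_exit_of_forall {ε : ℝ} {T : ℝ≥0} {x : C(ℝ, ℝ)}
    (h : ∀ u ∈ Icc (0 : ℝ) T, |x u - π| ≤ π - 2 * ε) :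
    (T : WithTop ℝ≥0) ≤ ratExceed (fun (t : ℝ≥0) (x : C(ℝ, ℝ)) ↦ |coordProc t x - π|) (π - 2 * ε) x := by
  refine le_ratExceed_of_forall fun q hq ↦ ?_
  simp only [coordProc_apply]
  exact h _ ⟨NNReal.coe_nonneg _, NNReal.coe_le_coe.2 hq⟩

/-- A continuous path lying in `(0, 2π)` on `[0, T]` stays within distance `π - 2ε` of `π` there for
some `ε = π / (n + 4)`. [folklore] -/
theorem exists_forall_abs_sub_pi_le {T : ℝ≥0} {x : C(ℝ, ℝ)}
    (h : ∀ u ∈ Icc (0 : ℝ) T, x u ∈ Ioo 0 (2 * π)) :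
    ∃ n : ℕ, ∀ u ∈ Icc (0 : ℝ) T, |x u - π| ≤ π - 2 * (π / (n + 4)) := by
  have hc : ContinuousOn (fun u ↦ |x u - π|) (Icc (0 : ℝ) T) :=
    (continuous_abs.comp (x.continuous.sub continuous_const)).continuousOn
  obtain ⟨u₀, hu₀, hmax⟩ := isCompact_Icc.exists_isMaxOn (nonempty_Icc.2 T.coe_nonneg) hc
  have hm : |x u₀ - π| < π := by
    rw [abs_sub_lt_iff]; constructor <;> linarith [(h u₀ hu₀).1, (h u₀ hu₀).2]
  obtain ⟨n, hn⟩ := exists_nat_gt (2 * π / (π - |x u₀ - π|))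
  refine ⟨n, fun u hu ↦ (hmax hu).trans ?_⟩
  show |x u₀ - π| ≤ π - 2 * (π / (n + 4))
  have hpos : 0 < π - |x u₀ - π| := sub_pos.2 hm
  have hn4 : (0 : ℝ) < n + 4 := by positivity
  rw [div_lt_iff₀ hpos] at hn
  rw [show 2 * (π / (n + 4)) = 2 * π / (n + 4) by ring, le_sub_comm, div_le_iff₀ hn4]
  nlinarith

/-! ### The theorem -/

/-- **The driving-angle increment of SLE_κ(ρ) is absolutely continuous with respect to Brownian
motion on compact time intervals.** Let `P` be a probability measure on `C(ℝ, ℝ)` solving the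
SLE_κ(ρ) angle martingale problem (`hMP`), with the angle in `(0, 2π)` on `[0, T]` a.s. If a set
`Bad` of paths `ℝ≥0 → ℝ` is null for the `T`-stopped path `t ↦ B_{t ∧ T}` of EVERY real Brownian
motion `B` (on any probability space, with measurable marginals and continuous paths), then
`P(ξ ∈ Bad) = 0` for the normalised driving increment
`ξ_t = (X_{t∧T} - X_0 - ∫₀^{t∧T} cot(X_u/2) du)/√κ`. (Proof: for `ε = π/(n+4)`, under the equivalent
tilted measure `Q_ε` of `exists_hasMartingaleClock_drivingIncrement` the increment stopped at the
exit time `τ_ε` of `[2ε, 2π - 2ε]` has martingale clock `t ∧ (T ∧ τ_ε)`; its concatenation with an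
independent Brownian motion is a Brownian motion (`isBrownianReal_concat`) whose `T`-stopped path is
`ξ` on `{T ≤ τ_ε}`; so `Q_ε(ξ ∈ Bad, T ≤ τ_ε) = 0`, hence `P(ξ ∈ Bad, T ≤ τ_ε) = 0`, and
`⋃_ε {T ≤ τ_ε}` is `P`-full because the angle stays inside `(0, 2π)` on `[0, T]`.) Miller–Sheffield
(2013), proof of Prop. 2.5 (absolute continuity of the whole-plane SLE_κ(ρ) driving function with
respect to radial SLE_κ away from the starting time, via Girsanov).
[cite: MillerSheffield2013, Prop. 2.5 (proof)] -/
theorem drivingIncrement_null_of_brownian_null [IsProbabilityMeasure P] (hκ : 0 < κ)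
    (hMP : ∀ f : ℝ → ℝ, ContDiff ℝ 2 f → HasCompactSupport f → tsupport f ⊆ Ioo 0 (2 * π) →
      Martingale (fun (t : ℝ≥0) x ↦ angleIncrement κ ρ f 0 t x) pastFiltration P)
    (T : ℝ≥0) (hIoo : ∀ᵐ x ∂P, ∀ u ∈ Icc (0 : ℝ) T, x u ∈ Ioo 0 (2 * π))
    {Bad : Set (ℝ≥0 → ℝ)}
    (hBad : ∀ (Ω' : Type) [MeasurableSpace Ω'] (P' : Measure Ω') [IsProbabilityMeasure P']
      (B : ℝ≥0 → Ω' → ℝ), IsBrownianReal B P' → (∀ t, Measurable (B t)) →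
      (∀ ω, Continuous (B · ω)) → P' {ω | (fun t ↦ B (min t T) ω) ∈ Bad} = 0) :
    P {x | (fun t : ℝ≥0 ↦ (x (min t T) - x 0 - ∫ u in (0 : ℝ)..(min t T), Real.cot (x u / 2)) /
      Real.sqrt κ) ∈ Bad} = 0 := by
  haveI : IsProbabilityMeasure Process.preWienerMeasure := isProbabilityMeasure_preWienerMeasure'
  -- the increment process and its `T`-stopped path
  set ξ' : ℝ≥0 → C(ℝ, ℝ) → ℝ := fun t x ↦
    (x (min t T) - x 0 - ∫ u in (0 : ℝ)..(min t T), Real.cot (x u / 2)) / Real.sqrt κ with hξ'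
  -- the exit times
  set τ : ℕ → C(ℝ, ℝ) → WithTop ℝ≥0 := fun n ↦
    ratExceed (fun (t : ℝ≥0) (x : C(ℝ, ℝ)) ↦ |coordProc t x - π|) (π - 2 * (π / (n + 4))) with hτ
  -- Step 1: `P(ξ ∈ Bad, T ≤ τ_n) = 0`
  have step : ∀ n : ℕ, P {x | (fun t ↦ ξ' t x) ∈ Bad ∧ (T : WithTop ℝ≥0) ≤ τ n x} = 0 := by
    intro n
    have hε : (0 : ℝ) < π / (n + 4) := by positivity
    have hε2 : π / (n + 4) < π / 2 :=
      div_lt_div_of_pos_left Real.pi_pos (by norm_num) (by norm_cast; omega)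
    obtain ⟨Q, hQ, hPQ, -, hYc, hYad, N, hclk⟩ :=
      exists_hasMartingaleClock_drivingIncrement (P := P) (ρ := ρ) hκ hMP hε hε2 T
    have hτo : IsOptionalTime pastFiltration (τ n) := isOptionalTime_exit _
    -- the clock in the form `t ∧ σ`
    set σ : C(ℝ, ℝ) → ℝ≥0 := fun x ↦ (min (T : WithTop ℝ≥0) (τ n x)).untopA with hσ
    set Y : ℝ≥0 → C(ℝ, ℝ) → ℝ := stoppedProcess ξ' (τ n) with hY
    have hclk' : HasMartingaleClock Y (fun t x ↦ ((min t (σ x) : ℝ≥0) : ℝ)) pastFiltration Q N := by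
      have hfun : (fun (t : ℝ≥0) (x : C(ℝ, ℝ)) ↦ ((min (min (t : WithTop ℝ≥0) (τ n x)).untopA T : ℝ≥0) : ℝ)) =
          fun t x ↦ ((min t (σ x) : ℝ≥0) : ℝ) := by
        funext t x
        rw [min_untopA_min_eq]
      rw [hfun] at hclk
      exact hclk
    have hσm : Measurable σ := (hτo.measurable_untopA_min T).mono (pastFiltration.le T) le_rfl
    have hcad : ∀ t, Measurable[pastFiltration t] fun x ↦ min t (σ x) := by
      intro t
      have : (fun x ↦ min t (σ x)) = fun x ↦ min (min (t : WithTop ℝ≥0) (τ n x)).untopA T := by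
        funext x; rw [min_untopA_min_eq]
      rw [this]
      exact (hτo.measurable_untopA_min t).min measurable_const
    have hY0 : ∀ x, Y 0 x = 0 := by
      intro x
      simp only [hY, stoppedProcess, untopA_min_zero, hξ']
      have : min ((0 : ℝ≥0) : ℝ) (T : ℝ) = 0 := min_eq_left T.coe_nonneg
      rw [NNReal.coe_zero] at this ⊢
      rw [this]
      simp
    -- the concatenation is a Brownian motion
    have hBM := isBrownianReal_concat (Q := Q) (𝓕 := pastFiltration) hclk' hYc hYad hσm hcad hY0 rfl
    have hnull := hBad (C(ℝ, ℝ) × (ℝ≥0 → ℝ)) (Q.prod Process.preWienerMeasure) _ hBM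
      (measurable_concat rfl hYad hcad) (continuous_concat rfl hYc)
    -- before `T ≤ τ_n` the stopped concatenation is `ξ`
    have hsub : {x | (fun t ↦ ξ' t x) ∈ Bad ∧ (T : WithTop ℝ≥0) ≤ τ n x} ×ˢ (univ : Set (ℝ≥0 → ℝ)) ⊆
        {ω | (fun t ↦ Y (min t T) ω.1 + (Process.brownian (min t T) ω.2 -
          Process.brownian (min (min t T) (σ ω.1)) ω.2)) ∈ Bad} := by
      rintro ⟨x, w⟩ ⟨⟨hx, hT⟩, -⟩
      have hσT : σ x = T := by simp only [hσ]; exact untopA_min_of_le hT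
      have heq : (fun t ↦ Y (min t T) x + (Process.brownian (min t T) w -
          Process.brownian (min (min t T) (σ x)) w)) = fun t ↦ ξ' t x := by
        funext t
        rw [hσT, min_eq_left (min_le_right t T), sub_self, add_zero]
        simp only [hY, stoppedProcess]
        have h1 : (min ((min t T : ℝ≥0) : WithTop ℝ≥0) (τ n x)).untopA = min t T :=
          untopA_min_of_le ((WithTop.coe_le_coe.2 (min_le_right t T)).trans hT)
        rw [h1]
        simp only [hξ']
        push_cast
        rw [min_assoc, min_self]
      show (fun t ↦ Y (min t T) x + (Process.brownian (min t T) w -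
          Process.brownian (min (min t T) (σ x)) w)) ∈ Bad
      rw [heq]
      exact hx
    have hQ0 : Q {x | (fun t ↦ ξ' t x) ∈ Bad ∧ (T : WithTop ℝ≥0) ≤ τ n x} = 0 := by
      have h1 := measure_mono (μ := Q.prod Process.preWienerMeasure) hsub
      rw [hnull, Measure.prod_prod, measure_univ, mul_one, nonpos_iff_eq_zero] at h1
      exact h1
    exact hPQ hQ0
  -- Step 2: the events `{T ≤ τ_n}` exhaust the path space a.s.
  have cover : ∀ᵐ x ∂P, ∃ n : ℕ, (T : WithTop ℝ≥0) ≤ τ n x := by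
    filter_upwards [hIoo] with x hx
    obtain ⟨n, hn⟩ := exists_forall_abs_sub_pi_le hx
    exact ⟨n, coe_le_exit_of_forall hn⟩
  -- conclusion
  have hsub : {x | (fun t ↦ ξ' t x) ∈ Bad} ⊆
      (⋃ n : ℕ, {x | (fun t ↦ ξ' t x) ∈ Bad ∧ (T : WithTop ℝ≥0) ≤ τ n x}) ∪
        {x | ¬ ∃ n : ℕ, (T : WithTop ℝ≥0) ≤ τ n x} := by
    intro x hx
    by_cases h : ∃ n : ℕ, (T : WithTop ℝ≥0) ≤ τ n x
    · obtain ⟨n, hn⟩ := h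
      exact Or.inl (mem_iUnion.2 ⟨n, hx, hn⟩)
    · exact Or.inr h
  exact measure_mono_null hsub (measure_union_null (measure_iUnion_null step) (ae_iff.1 cover))

/-- **Corollary for the stationary angle law.** Under a stationary SLE_κ(ρ) angle law `P`
(`IsStationaryAngleLaw κ ρ P`), the normalised driving increment on `[0, T]` charges no set that is
null for every real Brownian motion. [cite: MillerSheffield2013, Prop. 2.5 (proof)] -/
theorem IsStationaryAngleLaw.drivingIncrement_null_of_brownian_null (hP : IsStationaryAngleLaw κ ρ P)
    (hκ : 0 < κ) (T : ℝ≥0) {Bad : Set (ℝ≥0 → ℝ)}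
    (hBad : ∀ (Ω' : Type) [MeasurableSpace Ω'] (P' : Measure Ω') [IsProbabilityMeasure P']
      (B : ℝ≥0 → Ω' → ℝ), IsBrownianReal B P' → (∀ t, Measurable (B t)) →
      (∀ ω, Continuous (B · ω)) → P' {ω | (fun t ↦ B (min t T) ω) ∈ Bad} = 0) :
    P {x | (fun t : ℝ≥0 ↦ (x (min t T) - x 0 - ∫ u in (0 : ℝ)..(min t T), Real.cot (x u / 2)) /
      Real.sqrt κ) ∈ Bad} = 0 := by
  haveI := hP.isProbabilityMeasure
  refine RandomPlanarGeometry.drivingIncrement_null_of_brownian_null hκ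
    (fun f hf hc hs ↦ hP.martingale_angleIncrement hf hc hs) T ?_ hBad
  filter_upwards [hP.2.1] with x hx u _ using hx u

/-! ### Shifting the base time by stationarity -/

/-- **The same absolute continuity from every base time**, by stationarity: under a stationary
SLE_κ(ρ) angle law, for every base time `b ∈ ℝ` the normalised driving increment after `b`,
`ξ^b_t = (X_{b + t∧T} - X_b - ∫_b^{b + t∧T} cot(X_u/2) du)/√κ = (λ_{b + t∧T} - λ_b)/√κ`, charges no
set that is null for every real Brownian motion (the law of `ξ^b` is that of `ξ^0` since
`P ∘ (timeShift b)⁻¹ = P`). This is the form used at the base times `T → -∞` of Miller–Sheffield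
(2013), proof of Prop. 2.5 ("the driving function of a whole-plane SLE_κ^μ(ρ) process is
time-stationary and we can take `T` to be as small as we like").
[cite: MillerSheffield2013, Prop. 2.5 (proof)] -/
theorem IsStationaryAngleLaw.drivingIncrement_shift_null_of_brownian_null
    (hP : IsStationaryAngleLaw κ ρ P) (hκ : 0 < κ) (b : ℝ) (T : ℝ≥0) {Bad : Set (ℝ≥0 → ℝ)}
    (hBad : ∀ (Ω' : Type) [MeasurableSpace Ω'] (P' : Measure Ω') [IsProbabilityMeasure P']
      (B : ℝ≥0 → Ω' → ℝ), IsBrownianReal B P' → (∀ t, Measurable (B t)) →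
      (∀ ω, Continuous (B · ω)) → P' {ω | (fun t ↦ B (min t T) ω) ∈ Bad} = 0) :
    P {x | (fun t : ℝ≥0 ↦ (x (b + min (t : ℝ) T) - x b -
      ∫ u in b..(b + min (t : ℝ) T), Real.cot (x u / 2)) / Real.sqrt κ) ∈ Bad} = 0 := by
  have h0 := hP.drivingIncrement_null_of_brownian_null hκ T hBad
  -- null sets pull back along the measure-preserving shift (`P(f⁻¹S) ≤ (P.map f)(S)`)
  have h1 : P (timeShift b ⁻¹' {x | (fun t : ℝ≥0 ↦ (x (min t T) - x 0 -
      ∫ u in (0 : ℝ)..(min t T), Real.cot (x u / 2)) / Real.sqrt κ) ∈ Bad}) = 0 :=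
    le_antisymm ((Measure.le_map_apply (measurable_timeShift b).aemeasurable _).trans
      (by rw [hP.map_timeShift b, h0])) bot_le
  refine measure_mono_null (fun x hx ↦ ?_) h1
  simp only [mem_preimage, mem_setOf_eq, timeShift_apply, add_zero]
  have heq : (fun t : ℝ≥0 ↦ (x (b + min (t : ℝ) T) - x b -
      ∫ u in (0 : ℝ)..(min (t : ℝ) T), Real.cot (x (b + u) / 2)) / Real.sqrt κ) =
      fun t : ℝ≥0 ↦ (x (b + min (t : ℝ) T) - x b -
        ∫ u in b..(b + min (t : ℝ) T), Real.cot (x u / 2)) / Real.sqrt κ := by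
    funext t
    rw [intervalIntegral.integral_comp_add_left (fun u ↦ Real.cot (x u / 2)) b, add_zero]
  rw [heq]
  exact hx

end Literature.Probability.RandomPlanarGeometry
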